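import Mathlib
import Summits.MatrixMultiplication.MatrixMultiplication.Theorems.HiddenToeplitzCornersHiddenCornerLemmaRStein

/-!
# Level theorem: kernel triviality from scale vanishing (hidden-corner lemma, crux stmt-MatrixMultiplication-10752)

Support file for crux item `stmt-MatrixMultiplication-10752`
(`Summit.MatrixMultiplication.MatrixMultiplication.Theses.HiddenToeplitzCorners.HiddenCornerLemmaR`).
With `Z` the lower shift (written verbatim), `L(g_k) = Σ_i G₀ i k • Z^i` and
`U(h_k) = Σ_i H k i • (Zᵀ)^i`, the theorem `hclR_kernel_trivial_of_scaleVanishing` says: if the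
frame `E` lives in degrees `≤ D`, every window `[τ, τ + w)` (`τ ≤ D`) contains the degree of a vector
of the column span of `E`, and the generators admit no nonzero syzygy `Σ_k L(g_k) β_k = 0` with all
`β_k` supported in degrees `< w`, then a class member `Σ_k L(g_k) U(h_k)` killing the frame has all
`h_k` vanishing in degrees `≤ D`.  Proof: strong induction on the degree; at the least surviving
degree `t` one feeds `β_k := U(h_k) v` (for a span vector `v` of degree in `[t, t + w)`) into the
scale-vanishing hypothesis. [folklore]
-/

set_option linter.dupNamespace false

namespace Summit.MatrixMultiplication.MatrixMultiplication.Theorems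

open Matrix BigOperators Finset

/-- Entries of `U(h) *ᵥ v` for the upper-triangular Toeplitz operator `U(h) = Σ_j h j • (Zᵀ)^j`:
`(U(h) v)_n = Σ_j h j · v (n + j)` (terms with `n + j ≥ N` dropped). -/
theorem hclR_upperToeplitz_mulVec_apply {N : ℕ} (h v : Fin N → ℂ) (n : Fin N) :
    ((∑ j : Fin N, h j •
        (Matrix.of fun i j : Fin N => if (i : ℕ) = (j : ℕ) + 1 then (1 : ℂ) else 0)ᵀ ^ (j : ℕ)) *ᵥ v) n =
      ∑ j : Fin N, h j * (if hh : (n : ℕ) + (j : ℕ) < N then v ⟨(n : ℕ) + (j : ℕ), hh⟩ else 0) := by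
  rw [Matrix.sum_mulVec, Finset.sum_apply]
  refine Finset.sum_congr rfl fun j _ => ?_
  rw [Matrix.smul_mulVec, Pi.smul_apply, hclR_shiftT_pow_mulVec, smul_eq_mul]

/-- A matrix killing every column of `E` kills the column span of `E`. -/
theorem hclR_mulVec_eq_zero_of_mem_span_col {N r : ℕ} (K : Matrix (Fin N) (Fin N) ℂ)
    (E : Matrix (Fin N) (Fin r) ℂ) (hK : ∀ c : Fin r, K *ᵥ (Eᵀ c) = 0)
    (v : Fin N → ℂ) (hv : v ∈ Submodule.span ℂ (Set.range E.col)) : K *ᵥ v = 0 := by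
  have hle : Submodule.span ℂ (Set.range E.col) ≤ LinearMap.ker (Matrix.mulVecLin K) := by
    rw [Submodule.span_le]
    rintro _ ⟨c, rfl⟩
    rw [SetLike.mem_coe, LinearMap.mem_ker, Matrix.mulVecLin_apply]
    exact hK c
  have := hle hv
  rwa [LinearMap.mem_ker, Matrix.mulVecLin_apply] at this

set_option linter.unusedVariables false in
/-- **Level theorem (kernel triviality from scale vanishing).**  `Z` is the lower shift written
verbatim; `L(g_k) = Σ_i G₀ i k • Z^i`, `U(h_k) = Σ_i H k i • (Zᵀ)^i`.  If the frame `E` lives in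
degrees `≤ D`, every window `[τ, τ + w)` with `τ ≤ D` contains the degree of some frame vector, and
the generators admit no nonzero syzygy `Σ_k L(g_k) β_k = 0` with all `β_k` supported in degrees
`< w` (scale vanishing `Z_w(G) = 0`), then a class member `Σ_k L(g_k) U(h_k)` killing the frame has
every `h_k` vanishing in degrees `≤ D` (hence it kills all of `V_{D+1}`, the Krylov span of the frame). -/
theorem hclR_kernel_trivial_of_scaleVanishing :
    ∀ (N p r w D : ℕ) (G₀ : Matrix (Fin N) (Fin p) ℂ) (E : Matrix (Fin N) (Fin r) ℂ)
      (H : Fin p → (Fin N → ℂ)),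
      (∀ (c : Fin r) (m : Fin N), D < (m : ℕ) → E m c = 0) →
      (∀ τ : ℕ, τ ≤ D → ∃ v ∈ Submodule.span ℂ (Set.range E.col), ∃ d : Fin N,
          τ ≤ (d : ℕ) ∧ (d : ℕ) < τ + w ∧ v d ≠ 0 ∧ ∀ m : Fin N, (d : ℕ) < (m : ℕ) → v m = 0) →
      (∀ β : Fin p → (Fin N → ℂ), (∀ (k : Fin p) (m : Fin N), w ≤ (m : ℕ) → β k m = 0) →
          (∑ k : Fin p, (∑ i : Fin N, G₀ i k •
              (Matrix.of fun i j : Fin N => if (i : ℕ) = (j : ℕ) + 1 then (1 : ℂ) else 0) ^ (i : ℕ))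
            *ᵥ β k) = 0 →
          β = 0) →
      (∀ c : Fin r, (∑ k : Fin p,
          ((∑ i : Fin N, G₀ i k •
              (Matrix.of fun i j : Fin N => if (i : ℕ) = (j : ℕ) + 1 then (1 : ℂ) else 0) ^ (i : ℕ)) *
            (∑ i : Fin N, H k i •
              (Matrix.of fun i j : Fin N => if (i : ℕ) = (j : ℕ) + 1 then (1 : ℂ) else 0)ᵀ ^ (i : ℕ))))
          *ᵥ (Eᵀ c) = 0) →
      ∀ (k : Fin p) (m : Fin N), (m : ℕ) ≤ D → H k m = 0 := by
  intro N p r w D G₀ E H hE hwin hsv hker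
  -- Strong induction on the degree `m`.
  suffices main : ∀ (m : ℕ) (hm : m < N), m ≤ D → ∀ k : Fin p, H k ⟨m, hm⟩ = 0 by
    intro k m hmD
    exact main m m.2 hmD k
  intro m
  induction m using Nat.strong_induction_on with
  | _ m ih =>
  intro hmN hmD
  by_contra hex
  obtain ⟨k₀, hk₀⟩ := not_forall.mp hex
  -- all `h_k` vanish strictly below degree `m`
  have hHlow : ∀ (k : Fin p) (j : Fin N), (j : ℕ) < m → H k j = 0 := by
    intro k j hj
    have := ih j hj j.2 (by omega) k
    simpa using this
  -- a span vector of degree `d ∈ [m, m + w)`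
  obtain ⟨v, hvspan, d, hmd, hdw, hvd, hvabove⟩ := hwin m hmD
  have hvabove' : ∀ (a : ℕ) (ha : a < N), (d : ℕ) < a → v ⟨a, ha⟩ = 0 :=
    fun a ha hlt => hvabove ⟨a, ha⟩ hlt
  -- `β_k := U(h_k) v`
  obtain ⟨β, hβ⟩ : ∃ β : Fin p → (Fin N → ℂ), ∀ k, β k =
      (∑ i : Fin N, H k i •
        (Matrix.of fun i j : Fin N => if (i : ℕ) = (j : ℕ) + 1 then (1 : ℂ) else 0)ᵀ ^ (i : ℕ)) *ᵥ v :=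
    ⟨_, fun _ => rfl⟩
  have hβapply : ∀ (k : Fin p) (n : Fin N), β k n =
      ∑ j : Fin N, H k j * (if hh : (n : ℕ) + (j : ℕ) < N then v ⟨(n : ℕ) + (j : ℕ), hh⟩ else 0) := by
    intro k n
    rw [hβ, hclR_upperToeplitz_mulVec_apply]
  -- `β_k` is supported in degrees `< w`
  have hβsupp : ∀ (k : Fin p) (n : Fin N), w ≤ (n : ℕ) → β k n = 0 := by
    intro k n hn
    rw [hβapply]
    refine Finset.sum_eq_zero fun j _ => ?_
    by_cases hj : (j : ℕ) < m
    · rw [hHlow k j hj, zero_mul]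
    · by_cases hh : (n : ℕ) + (j : ℕ) < N
      · rw [dif_pos hh, hvabove' _ hh (by omega), mul_zero]
      · rw [dif_neg hh, mul_zero]
  -- `Σ_k L(g_k) β_k = K v = 0`, so scale vanishing forces `β = 0`
  have hβzero : β = 0 := by
    refine hsv β hβsupp ?_
    have := hclR_mulVec_eq_zero_of_mem_span_col _ E hker v hvspan
    rw [Matrix.sum_mulVec] at this
    simpa only [hβ, Matrix.mulVec_mulVec] using this
  -- but the entry of `β_{k₀}` in degree `d - m` is `H k₀ m * v d ≠ 0`
  have hdm : (d : ℕ) - m < N := by omega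
  have hβne : β k₀ ⟨(d : ℕ) - m, hdm⟩ ≠ 0 := by
    rw [hβapply, Finset.sum_eq_single ⟨m, hmN⟩]
    · have hh : (d : ℕ) - m + m < N := by omega
      dsimp only
      rw [dif_pos hh]
      have : (⟨(d : ℕ) - m + m, hh⟩ : Fin N) = d := Fin.ext (show (d : ℕ) - m + m = d by omega)
      rw [this]
      exact mul_ne_zero hk₀ hvd
    · intro j _ hjm
      by_cases hj : (j : ℕ) < m
      · rw [hHlow k₀ j hj, zero_mul]
      · have hlt : m < (j : ℕ) :=
          lt_of_le_of_ne (not_lt.mp hj) (fun h => hjm (Fin.ext (show (j : ℕ) = m by omega)))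
        by_cases hh : (d : ℕ) - m + (j : ℕ) < N
        · dsimp only
          rw [dif_pos hh, hvabove' _ hh (by omega), mul_zero]
        · dsimp only
          rw [dif_neg hh, mul_zero]
    · intro h
      exact absurd (Finset.mem_univ _) h
  exact hβne (by rw [hβzero]; rfl)

end Summit.MatrixMultiplication.MatrixMultiplication.Theorems
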